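import Summits.AnomalousDissipation.AnomalousDissipation.Theorems.SolenoidalFractalHomogenisationLagrangianCarrierAnalyticHigherGradients
import Summits.AnomalousDissipation.AnomalousDissipation.Theorems.SolenoidalFractalHomogenisationLagrangianCarrierAnalyticTower
import Summits.AnomalousDissipation.AnomalousDissipation.Theorems.SolenoidalFractalHomogenisationLagrangianStepClosedWindow
import HarnessLib

/-!
# Analytic tower of a Lagrangian lattice carrier, VI: the coarse window displacement has ALL label-gradients `O(strain)`
# (helper for K1L_D `stmt-AnomalousDissipation-27980`, (ℓ3-A) road A `…FrameInstanceRegularity` (F6); `--supports`)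

Summits-side helper file (everything proved; no definitions, no named facts).  `abs_iterPartialDeriv_disp_le_strain`: for every design `W`
(pre-stretch `M`) there are `θs, C_D, ϱ_D > 0` such that every `LPermissible`, `Regular` Lagrangian lattice carrier of design `W.stretch M` with
strain ceiling `θ (i+1) ≤ θs` and separation `N_m² ≤ N_{m+1}` satisfies, on every CLOSED refresh window of level `m+1` (`0 ≤ u ≤ refresh (m+1)`),
`|∂^l (disp m (jR+u) (jR))_a (y)| ≤ C_D · n! · strain m · (ϱ_D N_m)ⁿ` for every word `l` of length `n+1 ≥ 1` — the abstract window estimate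
`abs_iterPartialDeriv_disp_le_forward_ofDerivWithin` (file `…AnalyticHigherGradients`, AV App. A Prop. 7.6/7.11 road; order one: AV Prop. 7.10
`abs_partialDeriv_disp_le_forward_ofDerivWithin`) fed with the analytic
tower `analytic_tower` at the common radius `ρ_* N_m` (`dnorm_partialSum_le`: `C_f = 3C_bS/N_m`, `R_f = ρ_*N_m`, so `C_fR_fu = 3C_bρ_* Su ≤ 3C_bρ_*·strain m`)
and the short-window clause `window_time_le`; level `m = 0` has no coarse field.  This is the (F6) ingredient of `IsFrameRegular6` for the clamped
exact-flow frame (orders `2…7` of `disp`).  Infrastructure for route-1's rung leaf F-D1.A0 (a frontier FORMAL rung); NOT a proof of K1L_D or of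
anomalous dissipation.
-/

set_option linter.dupNamespace false

noncomputable section

namespace Summit.AnomalousDissipation.AnomalousDissipation.Theorems.SolenoidalFractalHomogenisation.LagrangianCarrierAnalytic

/-! ## §5 The coarse displacement of a Lagrangian lattice carrier on a refresh window -/

section Carrier

open Set Function Filter Topology MeasureTheory
open scoped ContDiff NNReal
open Literature.Analysis Literature.Analysis.ODE Literature.Analysis.ODE.TorusFlow
open Literature.Analysis.FunctionSpaces Literature.Analysis.FunctionSpaces.Torus
open Literature.Analysis.FluidPDE Literature.Analysis.FluidPDE.LatticeShear
open Summit.AnomalousDissipation.AnomalousDissipation.Theorems.SolenoidalFractalHomogenisation.LagrangianStep (FrameConj.window_disp_clauses_closed)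

variable {k : ℕ}

/-- **ALL label-gradients of the window displacement are `O(strain)`.**  For every design `W` (pre-stretch `M`) there are `θs, C_D, ϱ_D > 0`
such that every `LPermissible`, `Regular` carrier of design `W.stretch M` with ceiling `θ (i+1) ≤ θs` and separation `N_m² ≤ N_{m+1}` satisfies,
on every refresh window of level `m+1` (`0 ≤ u ≤ refresh (m+1)`), for every word `l` of length `n + 1 ≥ 1`, component `a` and label `y`:
`|∂^l (disp m (jR+u) (jR))_a (y)| ≤ C_D · n! · strain m · (ϱ_D N_m)ⁿ` (§4 fed with the analytic tower at the common radius `ρ_* N_m`,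
`C_f R_f u = 3 C_b ρ_* S u ≤ 3 C_b ρ_* · strain m`).  [cite: ArmstrongVicol2025, App. A Prop. 7.6, Prop. 7.11, (A.1); §2.2 (PDF p. 12, p. 18)] -/
theorem abs_iterPartialDeriv_disp_le_strain (k : ℕ) (W : LatticeWord k) (M : ℝ) (hM : 0 < M) :
    ∃ θs : ℝ, 0 < θs ∧ ∃ CD : ℝ, 0 < CD ∧ ∃ ϱD : ℝ, 0 < ϱD ∧
      ∀ E : LagrangianLatticeCarrier k, E.design = W.stretch M hM → E.LPermissible → E.Regular →
        (∀ i, E.θ (i + 1) ≤ θs) → (∀ m, E.N m ^ 2 ≤ E.N (m + 1)) →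
        ∀ (m : ℕ) (j : ℤ) (u : ℝ), 0 ≤ u → u ≤ E.refresh (m + 1) →
          ∀ (l : List (Fin 3)) (n : ℕ), l.length = n + 1 → ∀ (a : Fin 3) (y : UnitAddTorus (Fin 3)),
            |iterPartialDeriv l (fun z => E.disp m ((j : ℝ) * E.refresh (m + 1) + u) ((j : ℝ) * E.refresh (m + 1)) z a) y|
              ≤ CD * (Nat.factorial n : ℝ) * E.strain m * (ϱD * E.N m) ^ n := by
  obtain ⟨ρs, hρs, Cb, hCb, θH, hθH, htower⟩ := analytic_tower k W M hM
  refine ⟨min θH (1 / (36 * Cb * ρs)), lt_min hθH (by positivity), 1296 * Cb * ρs, by positivity, 720 * ρs, by positivity, ?_⟩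
  intro E hdes hLP hReg hθ hsq m j u hu0 huR l n hl a y
  have hLR : E.LevelRegular := hReg.levelRegular
  have hN2 : ∀ m, 2 * E.N m ≤ E.N (m + 1) := hLP.permissible.2.2.1
  have hN : ∀ m, (0 : ℝ) < E.N m := fun m => by exact_mod_cast E.N_pos m
  have hlne : l ≠ [] := by intro h; subst h; simp at hl
  set w : ℝ := (j : ℝ) * E.refresh (m + 1) with hw
  rcases Nat.eq_zero_or_pos m with rfl | hmpos
  · -- no coarse field: the displacement vanishes identically
    have hF : E.IsFlow 0 := (hLP.isLagrangian 0).1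
    have hzero : (fun z => E.disp 0 (w + u) w z a) = fun _ => (0 : ℝ) := by
      funext z
      rw [hF.window_integral_eq w u z]
      have e : (fun r => E.partialSum 0 (w + r) (z + proj (E.disp 0 (w + r) w z))) = fun _ => 0 := by
        funext r; simp [LagrangianLatticeCarrier.partialSum]
      rw [e, intervalIntegral.integral_zero]
      rfl
    rw [hzero, iterPartialDeriv_const (0 : ℝ) l hlne]
    have hstrain0 : E.strain 0 = 0 := by simp [LagrangianLatticeCarrier.strain]
    simp [hstrain0]
  · obtain ⟨i, rfl⟩ : ∃ i, m = i + 1 := ⟨m - 1, by omega⟩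
    have hF : E.IsFlow (i + 1) := (hLP.isLagrangian (i + 1)).1
    set S : ℝ := ∑ j ∈ Finset.range (i + 1), E.a (j + 1) with hS
    have hS0 : 0 < S := by rw [hS]; exact Finset.sum_pos (fun j _ => E.a_pos _) ⟨0, by simp⟩
    set Rf : ℝ := ρs * E.N (i + 1) with hRf
    set Cf : ℝ := 3 * Cb * S / E.N (i + 1) with hCf
    have hRf0 : 0 < Rf := mul_pos hρs (hN _)
    have hCf0 : 0 < Cf := by rw [hCf]; exact div_pos (by positivity) (hN _)
    -- the field bounds at the common radius
    have hfb : ∀ n', 1 ≤ n' → n' ≤ n + 1 → ∀ t, dnorm n' Rf (E.partialSum (i + 1) (w + t)) ≤ Cf := by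
      intro n' hn' _ t
      have h := dnorm_partialSum_le E hLR hN2 i (fun _ => ρs) (fun _ => hρs) (fun _ _ => le_rfl) (Cb := Cb)
        (fun j' _ t' c n'' => by rw [mul_div_assoc]; exact htower E hdes hLP hReg (fun i' => (hθ i').trans (min_le_left _ _)) hsq j' t' c n'')
        hn' (w + t)
      rw [hRf, hCf, hS]; exact h
    -- the window is short
    have hθi : E.θ (i + 2) ≤ 1 / (36 * Cb * ρs) := (hθ (i + 1)).trans (min_le_right _ _)
    have hwin := window_time_le E hLP.strain_le i hρs hCb hθi huR
    have hT₀ : u ≤ 1 / (4 * (Fintype.card (Fin 3) : ℝ) * Cf * Rf) := by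
      have e : 4 * (Fintype.card (Fin 3) : ℝ) * Cf * Rf = 12 * (3 * Cb * S / E.N (i + 1)) * (ρs * E.N (i + 1)) := by
        rw [Fintype.card_fin, hCf, hRf]; push_cast; ring
      rw [e]; exact hwin
    -- the within-window chain rule
    obtain ⟨hbc, hbs, hbB, -⟩ := hLR.window_b_clauses (i + 1) w u
    obtain ⟨hDc, hDs', hDB⟩ := FrameConj.window_disp_clauses_closed E hLR (i + 1) j huR
    have hint : ∀ s' ∈ Icc 0 u, ∀ x, E.disp (i + 1) (w + s') w x =
        ∫ r in (0 : ℝ)..s', E.partialSum (i + 1) (w + r) (x + proj (E.disp (i + 1) (w + r) w x)) :=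
      fun s' _ x => hF.window_integral_eq w s' x
    have hDt := hasDerivWithinAt_iterPartialDeriv_disp hbc hbs hbB hDc hDs' hDB hint
    have hD0 : ∀ x, E.disp (i + 1) (w + 0) w x = 0 := fun x => by rw [add_zero]; exact disp_self_of_isFlow E hF w x
    have hc3 : (Fintype.card (Fin 3) : ℝ) = 3 := by simp
    have hNi := (hN (i + 1)).ne'
    have hSu : S * u ≤ E.strain (i + 1) := by
      have : E.strain (i + 1) = S * E.refresh (i + 1 + 1) := by rw [hS]; rfl
      rw [this]; exact mul_le_mul_of_nonneg_left huR hS0.le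
    rcases Nat.eq_zero_or_pos n with rfl | hn
    · -- order one: Prop. 7.10 (first display)
      obtain ⟨l', c, rfl, hl'⟩ := List.exists_eq_concat_of_length_eq_succ hl
      obtain rfl : l' = [] := List.eq_nil_of_length_eq_zero hl'
      have h1 := abs_partialDeriv_disp_le_forward_ofDerivWithin (f := fun r => E.partialSum (i + 1) (w + r))
        (D := fun r => E.disp (i + 1) (w + r) w) hCf0 hRf0 (le_refl 1) (fun r => hLR.isSmooth_partialSum (i + 1) _)
        (fun r => hLR.isSmooth_disp (i + 1) _ _) hD0 hT₀ (fun l' i' x t ht => hDt l' i' x ht) hfb (t := u) ⟨hu0, le_rfl⟩ c a y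
      rw [List.nil_append, iterPartialDeriv_cons, iterPartialDeriv_nil]
      refine h1.trans ?_
      have e1 : 8 * (Fintype.card (Fin 3) : ℝ) * Cf * Rf * u = 72 * Cb * ρs * (S * u) := by
        rw [hc3, hCf, hRf]; field_simp; ring
      rw [e1]
      simp only [Nat.factorial_zero, Nat.cast_one, pow_zero, mul_one]
      nlinarith [hSu, mul_nonneg hS0.le hu0, hCb.le, hρs.le, mul_nonneg hCb.le hρs.le,
        mul_nonneg (mul_nonneg hCb.le hρs.le) (mul_nonneg hS0.le hu0)]
    have hA := abs_iterPartialDeriv_disp_le_forward_ofDerivWithin (f := fun r => E.partialSum (i + 1) (w + r))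
      (D := fun r => E.disp (i + 1) (w + r) w) hCf0 hRf0 (fun r => hLR.isSmooth_partialSum (i + 1) _)
      (fun r => hLR.isSmooth_disp (i + 1) _ _) hD0 hT₀ (fun l' i' x t ht => hDt l' i' x ht) hfb n hn le_rfl u ⟨hu0, le_rfl⟩ l hl a y
    refine hA.trans ?_
    -- arithmetic
    have e1 : 48 * (Fintype.card (Fin 3) : ℝ) ^ 2 * Cf * Rf = 1296 * Cb * ρs * S := by
      rw [hc3, hCf, hRf]; field_simp; ring
    have e2 : 24 * (Fintype.card (Fin 3) : ℝ) * Rf * (1 + (Fintype.card (Fin 3) : ℝ) ^ 2) = 720 * ρs * E.N (i + 1) := by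
      rw [hc3, hRf]; ring
    rw [e1, e2]
    have hX0 : 0 ≤ (Nat.factorial n : ℝ) * (720 * ρs * E.N (i + 1)) ^ n := by positivity
    have hdiv : (Nat.factorial n : ℝ) * (720 * ρs * E.N (i + 1)) ^ n / ((n : ℝ) + 1) ^ 2 ≤
        (Nat.factorial n : ℝ) * (720 * ρs * E.N (i + 1)) ^ n := by
      refine div_le_self hX0 ?_
      have : (0 : ℝ) ≤ n := Nat.cast_nonneg n
      nlinarith
    have hK0 : 0 ≤ 1296 * Cb * ρs := by positivity
    calc 1296 * Cb * ρs * S * ((Nat.factorial n : ℝ) * (720 * ρs * E.N (i + 1)) ^ n / ((n : ℝ) + 1) ^ 2) * u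
        = 1296 * Cb * ρs * ((Nat.factorial n : ℝ) * (720 * ρs * E.N (i + 1)) ^ n / ((n : ℝ) + 1) ^ 2) * (S * u) := by ring
      _ ≤ 1296 * Cb * ρs * ((Nat.factorial n : ℝ) * (720 * ρs * E.N (i + 1)) ^ n) * E.strain (i + 1) := by
          refine mul_le_mul (mul_le_mul_of_nonneg_left hdiv hK0) hSu (mul_nonneg hS0.le hu0) (by positivity)
      _ = 1296 * Cb * ρs * (Nat.factorial n : ℝ) * E.strain (i + 1) * (720 * ρs * E.N (i + 1)) ^ n := by ring

end Carrier

end Summit.AnomalousDissipation.AnomalousDissipation.Theorems.SolenoidalFractalHomogenisation.LagrangianCarrierAnalytic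

end
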